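import Summits.Ventures.LatticeQCDFlow.Exactness.IMHCoupledEstimatorCorrectionTail
import Summits.Ventures.LatticeQCDFlow.Exactness.IMHCoupledUnbiasedEstimatorLagL
import HarnessLib

/-!
# The observable convergence diagnostic of the coupled exact sampler: for EVERY bounded observable at once,
# `|E f(Y_b) − π f| ≤ (c − a)·Σ_{n≥b} P(X_n ≠ X′_n) = (c − a)·E[#disagreements after time b]` — the remaining bias of the run at time `b` is
# bounded by the expected RESIDUAL MEETING TIME, the mean of a statistic one reads off the coupled pair

HONEST FRAMING: exact (Metropolis-corrected) sampling algorithms for lattice gauge theory;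
figures of merit are autocorrelation/cost numbers at stated couplings and volumes; no
continuum-physics claim.

Venture `LatticeQCDFlow` (cell pub-lqcd), topic `Exactness`; FANOUT row 30 (lean-1, GEN-39).  NEW WORK of the cell, general state space with
`MeasurableEq Ω`; sequel to GEN-36's `Exactness/IMHCoupledUnbiasedEstimator` (lag-one coupling `μ̂₀∘fst⁻¹ = (μ̂₀∘snd⁻¹)K`:
`Σ_{n≥0} E D_{b+n} = π f − E f(Y_b)` EXACTLY), GEN-37's `IMHCouplingBurnInDiagnostic` (the summed corrections estimate the bias OF ONE OBSERVABLE)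
and this generation's `…CorrectionTail` (`|D_n| ≤ (c − a)·1{Z_n ∉ Δ}`).  Here the bound is UNIFORM OVER OBSERVABLES: the printed counterpart
(named only, nothing cited) is the coupling-based total-variation diagnostic of Biswas–Jacob–Vanetti, `d_TV(law(Y_b), π) ≤ E[(τ − b)⁺]`, for the exact
sampler with lag one (`W = w(x₀)`, `r = 1 − 1/W`, `p₀ = μ̂₀(Δᶜ)`):

* §1 **`crnLag_integral_abs_diff_le_offDiagonal`** — `E|f(X′_n) − f(Y_n)| ≤ (c − a)·P(X_n ≠ X′_n)` (every coupling);
  **`crn_chain_summable_offDiagonal_shift`** — `n ↦ P(X_{b+n} ≠ X′_{b+n})` is summable, **`crn_chain_tsum_offDiagonal_shift_le`** — with sum `≤ r^b p₀ W`.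
* §2 **`crnLag_bias_abs_le_tsum_offDiagonal`** — LAG ONE: `|π f − E f(Y_b)| ≤ (c − a)·Σ_{n≥0} P(X_{b+n} ≠ X′_{b+n})` for EVERY measurable `a ≤ f ≤ c`
  and every `b`; **`crnLag_measureReal_sub_abs_le_tsum_offDiagonal`** — for every measurable set `S`: `|P(Y_b ∈ S) − π(S)| ≤ Σ_{n≥0} P(X_{b+n} ≠ X′_{b+n})`:
  A TOTAL-VARIATION BOUND whose right-hand side does not involve the observable.
* §3 **`crn_chain_integral_residualDisagreement_eq`** — `Σ_{n≥0} P(X_{b+n} ≠ X′_{b+n}) = E[Σ_{n≥0} 1{Z_{b+n} ∉ Δ}]` — the expected number of updates AFTER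
  time `b` on which the two runs still differ (the residual meeting time `(T − b)⁺`, a statistic of the coupled pair, estimable across replicas as in
  `…CoupledReplicasMeetingTimeAverage`), `≤ r^b p₀ W`: THE BIAS OF THE RUN AT TIME `b`, UNIFORMLY OVER OBSERVABLES, IS AT MOST THE EXPECTED RESIDUAL
  MEETING TIME (times the range) — a certified, observable, reference-free convergence diagnostic.
* §4 LAG `L ≥ 1` (the lag-`L` coupling of `…CoupledUnbiasedEstimatorLagL`, `μ̂₀∘fst⁻¹ = (μ̂₀∘snd⁻¹)K^L`): **`crnLagL_bias_abs_le_tsum_offDiagonal`** —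
  `|π f − E f(Y_k)| ≤ (c − a)·Σ_{j≥0} P(X_{k+jL} ≠ X′_{k+jL})` (only every `L`-th disagreement probability enters; the sum is `≤ r^k p₀/(1 − r^L)`,
  **`crn_chain_summable_offDiagonal_lagL`**), the set form **`crnLagL_measureReal_sub_abs_le_tsum_offDiagonal`**, and
  **`crn_chain_integral_residualDisagreement_lagL_eq`** — the right side is the expected number of READINGS after `k` on which the runs differ.
Reading (gauge files): run coupled pairs of the exact gauge sampler from the production start one update apart; the average number of updates after
time `b` on which the pair still differs bounds the systematic error at time `b` of EVERY bounded measurement (in units of its range).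
NOT CLAIMED: the pathwise identification of §3's count with `(T − b)⁺` and of §4's count with the printed `⌈(τ − L − k)/L⌉` (both need the
merged-forever structure — a.s. true, not re-typed here; the theorems are about the counts); sharpness; the closed form of the right side from `…MeetingTimeAnyCoupling` (it is
`E[(1 − A(h))^b/A(h); X_0 ≠ X′_0]` on standard Borel spaces — not re-typed); unbounded `f`; any value of `A`.  No `sorry`, no new definitions, nothing
cited as a fact.
-/

noncomputable section

namespace Summit.Ventures.LatticeQCDFlow.Exactness

open MeasureTheory ProbabilityTheory Function Finset Filter
open scoped ENNReal unitInterval Topology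
open Summit.Ventures.LatticeQCDFlow.Scoring

variable {Ω : Type*} [MeasurableSpace Ω] {q : Measure Ω} [IsProbabilityMeasure q] {w : Ω → ℝ}

/-! ## §1 Corrections are controlled by the one-time disagreement probabilities -/

/-- **`E|f(X′_n) − f(Y_n)| ≤ (c − a)·P(X_n ≠ X′_n)`** from every initial coupling (`MeasurableEq Ω`). [ours] -/
theorem crnLag_integral_abs_diff_le_offDiagonal [MeasurableEq Ω] (Khat : Kernel (Ω × Ω) (Ω × Ω)) [IsMarkovKernel Khat]
    (μ₀ : Measure (Ω × Ω)) [IsProbabilityMeasure μ₀] {f : Ω → ℝ} (hf : Measurable f) {a c : ℝ} (ha : ∀ x, a ≤ f x) (hc : ∀ x, f x ≤ c)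
    (n : ℕ) :
    ∫ z, |f ((z n).1) - f ((z n).2)| ∂(Kernel.trajMeasure (X := fun _ : ℕ => Ω × Ω) μ₀
        (fun n : ℕ => Khat.comap (fun h : (i : ↥(Finset.Iic n)) → Ω × Ω => h ⟨n, Finset.mem_Iic.2 le_rfl⟩)
          (measurable_pi_apply _))) ≤ (c - a) * ((fun m : Measure (Ω × Ω) => m.bind Khat)^[n] μ₀).real (Set.diagonal Ω)ᶜ := by
  set P := Kernel.trajMeasure (X := fun _ : ℕ => Ω × Ω) μ₀
      (fun n : ℕ => Khat.comap (fun h : (i : ↥(Finset.Iic n)) → Ω × Ω => h ⟨n, Finset.mem_Iic.2 le_rfl⟩)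
        (measurable_pi_apply _)) with hP
  have hD : MeasurableSet (Set.diagonal Ω) := measurableSet_diagonal
  have hIm : Measurable ((Set.diagonal Ω)ᶜ.indicator (1 : Ω × Ω → ℝ)) := measurable_one.indicator hD.compl
  have hI : Integrable (fun z : ℕ → Ω × Ω => (c - a) * (Set.diagonal Ω)ᶜ.indicator (1 : Ω × Ω → ℝ) (z n)) P :=
    (integrable_of_bounded P (hIm.comp (measurable_pi_apply n)) (fun z => abs_indicator_offDiagonal_le_one _)).const_mul _
  have hA : Integrable (fun z : ℕ → Ω × Ω => |f ((z n).1) - f ((z n).2)|) P :=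
    integrable_of_bounded P (((hf.comp (measurable_fst.comp (measurable_pi_apply n))).sub
      (hf.comp (measurable_snd.comp (measurable_pi_apply n)))).abs) (C := c - a) (fun z => by
        rw [abs_abs]; exact abs_sub_le_iff.2 ⟨by linarith [hc (z n).1, ha (z n).2], by linarith [hc (z n).2, ha (z n).1]⟩)
  calc ∫ z, |f ((z n).1) - f ((z n).2)| ∂P ≤ ∫ z, (c - a) * (Set.diagonal Ω)ᶜ.indicator (1 : Ω × Ω → ℝ) (z n) ∂P :=
        integral_mono hA hI fun z => abs_correction_le_indicator ha hc (z n)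
    _ = (c - a) * ((fun m : Measure (Ω × Ω) => m.bind Khat)^[n] μ₀).real (Set.diagonal Ω)ᶜ := by
        rw [integral_const_mul, hP, chain_expect_eq_integral_iterate_bind Khat μ₀ hIm (fun p => abs_indicator_offDiagonal_le_one p) n,
          integral_indicator_one hD.compl]

/-- **`n ↦ P(X_{b+n} ≠ X′_{b+n})` IS SUMMABLE** (`w` normalised, maximal at `x₀`; geometric envelope `r^{b+n} p₀`). [ours] -/
theorem crn_chain_summable_offDiagonal_shift [MeasurableEq Ω] (hw : Measurable w) (hw0 : ∀ y, 0 < w y) {x₀ : Ω}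
    (hmax : ∀ y, w y ≤ w x₀) [IsProbabilityMeasure (q.withDensity fun y => ENNReal.ofReal (w y))]
    (Khat : Kernel (Ω × Ω) (Ω × Ω)) [IsMarkovKernel Khat]
    (hK : ∀ z : Ω × Ω, Khat z = (q.prod (volume : Measure unitInterval)).map (fun p : Ω × unitInterval =>
      ((if (p.2 : ℝ) * w z.1 ≤ w p.1 then p.1 else z.1), (if (p.2 : ℝ) * w z.2 ≤ w p.1 then p.1 else z.2))))
    (μ₀ : Measure (Ω × Ω)) [IsProbabilityMeasure μ₀] (b : ℕ) :
    Summable (fun n => ((fun m : Measure (Ω × Ω) => m.bind Khat)^[b + n] μ₀).real (Set.diagonal Ω)ᶜ) ∧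
    ∑' n, ((fun m : Measure (Ω × Ω) => m.bind Khat)^[b + n] μ₀).real (Set.diagonal Ω)ᶜ ≤ (1 - (w x₀)⁻¹) ^ b * μ₀.real (Set.diagonal Ω)ᶜ * w x₀ := by
  have hW : 1 ≤ w x₀ := one_le_of_mode (q := q) hmax
  have hWpos : 0 < w x₀ := hw0 x₀
  have hr0 : 0 ≤ 1 - (w x₀)⁻¹ := sub_nonneg.2 (inv_le_one_of_one_le₀ hW)
  have hr1 : 1 - (w x₀)⁻¹ < 1 := sub_lt_self _ (inv_pos.2 hWpos)
  have hgeo : HasSum (fun n : ℕ => (1 - (w x₀)⁻¹) ^ b * μ₀.real (Set.diagonal Ω)ᶜ * (1 - (w x₀)⁻¹) ^ n)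
      ((1 - (w x₀)⁻¹) ^ b * μ₀.real (Set.diagonal Ω)ᶜ * w x₀) := by
    have h := (hasSum_geometric_of_lt_one hr0 hr1).mul_left ((1 - (w x₀)⁻¹) ^ b * μ₀.real (Set.diagonal Ω)ᶜ)
    rwa [sub_sub_cancel, inv_inv] at h
  have hle : ∀ n, ((fun m : Measure (Ω × Ω) => m.bind Khat)^[b + n] μ₀).real (Set.diagonal Ω)ᶜ ≤
      (1 - (w x₀)⁻¹) ^ b * μ₀.real (Set.diagonal Ω)ᶜ * (1 - (w x₀)⁻¹) ^ n := fun n => by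
    have h := iterate_bind_crnPair_offDiagonal_le hw hw0 hmax Khat hK (b + n) μ₀
    rw [pow_add] at h
    linarith [h]
  have hsum : Summable (fun n => ((fun m : Measure (Ω × Ω) => m.bind Khat)^[b + n] μ₀).real (Set.diagonal Ω)ᶜ) :=
    Summable.of_nonneg_of_le (fun n => measureReal_nonneg) hle hgeo.summable
  exact ⟨hsum, (hsum.tsum_le_tsum hle hgeo.summable).trans_eq hgeo.tsum_eq⟩

/-! ## §2 The bias at time `b`, uniformly over observables -/

/-- **`|π f − E f(Y_b)| ≤ (c − a)·Σ_{n≥0} P(X_{b+n} ≠ X′_{b+n})` FOR EVERY MEASURABLE `a ≤ f ≤ c`** under the lag-one coupling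
(`μ̂₀∘fst⁻¹ = (μ̂₀∘snd⁻¹)K`; `w` a `Fact`-measurable normalised weight maximal at `x₀`; `MeasurableEq Ω`). [ours] -/
theorem crnLag_bias_abs_le_tsum_offDiagonal [MeasurableEq Ω] [Fact (Measurable w)] (hw0 : ∀ y, 0 < w y) {x₀ : Ω}
    (hmax : ∀ y, w y ≤ w x₀) [IsProbabilityMeasure (q.withDensity fun y => ENNReal.ofReal (w y))]
    (Khat : Kernel (Ω × Ω) (Ω × Ω)) [IsMarkovKernel Khat]
    (hK : ∀ z : Ω × Ω, Khat z = (q.prod (volume : Measure unitInterval)).map (fun p : Ω × unitInterval =>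
      ((if (p.2 : ℝ) * w z.1 ≤ w p.1 then p.1 else z.1), (if (p.2 : ℝ) * w z.2 ≤ w p.1 then p.1 else z.2))))
    (μ₀ : Measure (Ω × Ω)) [IsProbabilityMeasure μ₀] (hlag : μ₀.map Prod.fst = (μ₀.map Prod.snd).bind (indepMH q w))
    {f : Ω → ℝ} (hf : Measurable f) {a c : ℝ} (ha : ∀ x, a ≤ f x) (hc : ∀ x, f x ≤ c) (b : ℕ) :
    |∫ x, f x ∂(q.withDensity fun y => ENNReal.ofReal (w y)) -
        ∫ z, f ((z b).2) ∂(Kernel.trajMeasure (X := fun _ : ℕ => Ω × Ω) μ₀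
          (fun n : ℕ => Khat.comap (fun h : (i : ↥(Finset.Iic n)) → Ω × Ω => h ⟨n, Finset.mem_Iic.2 le_rfl⟩)
            (measurable_pi_apply _)))| ≤
      (c - a) * ∑' n, ((fun m : Measure (Ω × Ω) => m.bind Khat)^[b + n] μ₀).real (Set.diagonal Ω)ᶜ := by
  have hw : Measurable w := Fact.out
  have hhas := crnLag_hasSum_integral_diff hw0 hmax Khat hK μ₀ hlag hf ha hc b
  obtain ⟨hsum, -⟩ := crn_chain_summable_offDiagonal_shift hw hw0 hmax Khat hK μ₀ b
  rw [← hhas.tsum_eq]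
  have hterm : ∀ n, ‖∫ z, (f ((z (b + n)).1) - f ((z (b + n)).2))
      ∂(Kernel.trajMeasure (X := fun _ : ℕ => Ω × Ω) μ₀
        (fun n : ℕ => Khat.comap (fun h : (i : ↥(Finset.Iic n)) → Ω × Ω => h ⟨n, Finset.mem_Iic.2 le_rfl⟩)
          (measurable_pi_apply _)))‖ ≤ (c - a) * ((fun m : Measure (Ω × Ω) => m.bind Khat)^[b + n] μ₀).real (Set.diagonal Ω)ᶜ := fun n => by
    rw [Real.norm_eq_abs]
    exact (abs_integral_le_integral_abs).trans (crnLag_integral_abs_diff_le_offDiagonal Khat μ₀ hf ha hc (b + n))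
  rw [← Real.norm_eq_abs, ← tsum_mul_left]
  exact tsum_of_norm_bounded (hsum.mul_left (c - a)).hasSum hterm

/-- **THE TOTAL-VARIATION FORM**: for every measurable set `S`, `|π(S) − P(Y_b ∈ S)| ≤ Σ_{n≥0} P(X_{b+n} ≠ X′_{b+n})` under the lag-one coupling —
a bound on the remaining bias of the run at time `b` that does not involve the observable. [ours] -/
theorem crnLag_measureReal_sub_abs_le_tsum_offDiagonal [MeasurableEq Ω] [Fact (Measurable w)] (hw0 : ∀ y, 0 < w y) {x₀ : Ω}
    (hmax : ∀ y, w y ≤ w x₀) [IsProbabilityMeasure (q.withDensity fun y => ENNReal.ofReal (w y))]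
    (Khat : Kernel (Ω × Ω) (Ω × Ω)) [IsMarkovKernel Khat]
    (hK : ∀ z : Ω × Ω, Khat z = (q.prod (volume : Measure unitInterval)).map (fun p : Ω × unitInterval =>
      ((if (p.2 : ℝ) * w z.1 ≤ w p.1 then p.1 else z.1), (if (p.2 : ℝ) * w z.2 ≤ w p.1 then p.1 else z.2))))
    (μ₀ : Measure (Ω × Ω)) [IsProbabilityMeasure μ₀] (hlag : μ₀.map Prod.fst = (μ₀.map Prod.snd).bind (indepMH q w))
    {S : Set Ω} (hS : MeasurableSet S) (b : ℕ) :
    |(q.withDensity fun y => ENNReal.ofReal (w y)).real S -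
        (Kernel.trajMeasure (X := fun _ : ℕ => Ω × Ω) μ₀
          (fun n : ℕ => Khat.comap (fun h : (i : ↥(Finset.Iic n)) → Ω × Ω => h ⟨n, Finset.mem_Iic.2 le_rfl⟩)
            (measurable_pi_apply _))).real {z | (z b).2 ∈ S}| ≤
      ∑' n, ((fun m : Measure (Ω × Ω) => m.bind Khat)^[b + n] μ₀).real (Set.diagonal Ω)ᶜ := by
  have h := crnLag_bias_abs_le_tsum_offDiagonal hw0 hmax Khat hK μ₀ hlag (measurable_one.indicator hS)
    (a := 0) (c := 1) (fun x => Set.indicator_nonneg (fun _ _ => zero_le_one) x)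
    (fun x => Set.indicator_le_self' (fun _ _ => zero_le_one) x) b
  rw [integral_indicator_one hS, sub_zero, one_mul] at h
  have hfun : (fun z : ℕ → Ω × Ω => S.indicator (1 : Ω → ℝ) ((z b).2)) =
      ({z : ℕ → Ω × Ω | (z b).2 ∈ S}).indicator (1 : (ℕ → Ω × Ω) → ℝ) := by
    funext z
    by_cases hz : (z b).2 ∈ S
    · rw [Set.indicator_of_mem hz, Set.indicator_of_mem (show z ∈ {z : ℕ → Ω × Ω | (z b).2 ∈ S} from hz)]; rfl
    · rw [Set.indicator_of_notMem hz, Set.indicator_of_notMem (show z ∉ {z : ℕ → Ω × Ω | (z b).2 ∈ S} from hz)]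
  have hSm : MeasurableSet {z : ℕ → Ω × Ω | (z b).2 ∈ S} := hS.preimage (measurable_snd.comp (measurable_pi_apply b))
  rw [hfun, integral_indicator_one hSm] at h
  exact h

/-! ## §3 The right side is the expected residual meeting time -/

/-- **`Σ_{n≥0} P(X_{b+n} ≠ X′_{b+n}) = E[Σ_{n≥0} 1{Z_{b+n} ∉ Δ}]`** — the expected number of updates after time `b` on which the runs still differ
(the residual meeting time), from every initial coupling; and `≤ r^b·p₀·W`. [ours] -/
theorem crn_chain_integral_residualDisagreement_eq [MeasurableEq Ω] (hw : Measurable w) (hw0 : ∀ y, 0 < w y) {x₀ : Ω}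
    (hmax : ∀ y, w y ≤ w x₀) [IsProbabilityMeasure (q.withDensity fun y => ENNReal.ofReal (w y))]
    (Khat : Kernel (Ω × Ω) (Ω × Ω)) [IsMarkovKernel Khat]
    (hK : ∀ z : Ω × Ω, Khat z = (q.prod (volume : Measure unitInterval)).map (fun p : Ω × unitInterval =>
      ((if (p.2 : ℝ) * w z.1 ≤ w p.1 then p.1 else z.1), (if (p.2 : ℝ) * w z.2 ≤ w p.1 then p.1 else z.2))))
    (μ₀ : Measure (Ω × Ω)) [IsProbabilityMeasure μ₀] (b : ℕ) :
    ∫ z, (∑' n, (Set.diagonal Ω)ᶜ.indicator (1 : Ω × Ω → ℝ) (z (b + n)))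
        ∂(Kernel.trajMeasure (X := fun _ : ℕ => Ω × Ω) μ₀
          (fun n : ℕ => Khat.comap (fun h : (i : ↥(Finset.Iic n)) → Ω × Ω => h ⟨n, Finset.mem_Iic.2 le_rfl⟩)
            (measurable_pi_apply _))) =
      ∑' n, ((fun m : Measure (Ω × Ω) => m.bind Khat)^[b + n] μ₀).real (Set.diagonal Ω)ᶜ ∧
    ∑' n, ((fun m : Measure (Ω × Ω) => m.bind Khat)^[b + n] μ₀).real (Set.diagonal Ω)ᶜ ≤ (1 - (w x₀)⁻¹) ^ b * μ₀.real (Set.diagonal Ω)ᶜ * w x₀ := by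
  set P := Kernel.trajMeasure (X := fun _ : ℕ => Ω × Ω) μ₀
      (fun n : ℕ => Khat.comap (fun h : (i : ↥(Finset.Iic n)) → Ω × Ω => h ⟨n, Finset.mem_Iic.2 le_rfl⟩)
        (measurable_pi_apply _)) with hP
  obtain ⟨hsum, hle⟩ := crn_chain_summable_offDiagonal_shift hw hw0 hmax Khat hK μ₀ b
  refine ⟨?_, hle⟩
  have hD : MeasurableSet (Set.diagonal Ω) := measurableSet_diagonal
  have hIm : Measurable ((Set.diagonal Ω)ᶜ.indicator (1 : Ω × Ω → ℝ)) := measurable_one.indicator hD.compl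
  have hIi : ∀ n, Integrable (fun z : ℕ → Ω × Ω => (Set.diagonal Ω)ᶜ.indicator (1 : Ω × Ω → ℝ) (z (b + n))) P := fun n =>
    integrable_of_bounded P (hIm.comp (measurable_pi_apply (b + n))) (fun z => abs_indicator_offDiagonal_le_one _)
  have hterm : ∀ n, ∫ z, (Set.diagonal Ω)ᶜ.indicator (1 : Ω × Ω → ℝ) (z (b + n)) ∂P =
      ((fun m : Measure (Ω × Ω) => m.bind Khat)^[b + n] μ₀).real (Set.diagonal Ω)ᶜ := fun n => by
    rw [hP, chain_expect_eq_integral_iterate_bind Khat μ₀ hIm (fun p => abs_indicator_offDiagonal_le_one p) (b + n),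
      integral_indicator_one hD.compl]
  have hnorm : ∀ n, ∫ z, ‖(Set.diagonal Ω)ᶜ.indicator (1 : Ω × Ω → ℝ) (z (b + n))‖ ∂P =
      ((fun m : Measure (Ω × Ω) => m.bind Khat)^[b + n] μ₀).real (Set.diagonal Ω)ᶜ := fun n => by
    rw [← hterm n]
    refine integral_congr_ae (ae_of_all _ fun z => ?_)
    dsimp only
    rw [Real.norm_eq_abs]
    exact abs_of_nonneg (Set.indicator_nonneg (fun _ _ => zero_le_one) _)
  have hsum' : Summable (fun n => ∫ z, ‖(Set.diagonal Ω)ᶜ.indicator (1 : Ω × Ω → ℝ) (z (b + n))‖ ∂P) := by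
    simp_rw [hnorm]; exact hsum
  rw [← integral_tsum_of_summable_integral_norm hIi hsum']
  exact tsum_congr hterm

/-! ## §4 Lag `L ≥ 1`: the first run `L` updates ahead, corrections read every `L` steps -/

/-- **`j ↦ P(X_{k+jL} ≠ X′_{k+jL})` IS SUMMABLE with sum `≤ r^k p₀/(1 − r^L)`** (`L ≥ 1`; every initial coupling). [ours] -/
theorem crn_chain_summable_offDiagonal_lagL [MeasurableEq Ω] (hw : Measurable w) (hw0 : ∀ y, 0 < w y) {x₀ : Ω}
    (hmax : ∀ y, w y ≤ w x₀) [IsProbabilityMeasure (q.withDensity fun y => ENNReal.ofReal (w y))]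
    (Khat : Kernel (Ω × Ω) (Ω × Ω)) [IsMarkovKernel Khat]
    (hK : ∀ z : Ω × Ω, Khat z = (q.prod (volume : Measure unitInterval)).map (fun p : Ω × unitInterval =>
      ((if (p.2 : ℝ) * w z.1 ≤ w p.1 then p.1 else z.1), (if (p.2 : ℝ) * w z.2 ≤ w p.1 then p.1 else z.2))))
    (μ₀ : Measure (Ω × Ω)) [IsProbabilityMeasure μ₀] (k : ℕ) {L : ℕ} (hL : 1 ≤ L) :
    Summable (fun j => ((fun m : Measure (Ω × Ω) => m.bind Khat)^[k + j * L] μ₀).real (Set.diagonal Ω)ᶜ) ∧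
    ∑' j, ((fun m : Measure (Ω × Ω) => m.bind Khat)^[k + j * L] μ₀).real (Set.diagonal Ω)ᶜ ≤
      (1 - (w x₀)⁻¹) ^ k * μ₀.real (Set.diagonal Ω)ᶜ / (1 - (1 - (w x₀)⁻¹) ^ L) := by
  have hW : 1 ≤ w x₀ := one_le_of_mode (q := q) hmax
  have hWpos : 0 < w x₀ := hw0 x₀
  have hr0 : 0 ≤ 1 - (w x₀)⁻¹ := sub_nonneg.2 (inv_le_one_of_one_le₀ hW)
  have hr1 : 1 - (w x₀)⁻¹ < 1 := sub_lt_self _ (inv_pos.2 hWpos)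
  have hrL0 : 0 ≤ (1 - (w x₀)⁻¹) ^ L := pow_nonneg hr0 L
  have hrL1 : (1 - (w x₀)⁻¹) ^ L < 1 := pow_lt_one₀ hr0 hr1 (by omega)
  have hgeo : HasSum (fun j : ℕ => (1 - (w x₀)⁻¹) ^ k * μ₀.real (Set.diagonal Ω)ᶜ * ((1 - (w x₀)⁻¹) ^ L) ^ j)
      ((1 - (w x₀)⁻¹) ^ k * μ₀.real (Set.diagonal Ω)ᶜ / (1 - (1 - (w x₀)⁻¹) ^ L)) := by
    have h := (hasSum_geometric_of_lt_one hrL0 hrL1).mul_left ((1 - (w x₀)⁻¹) ^ k * μ₀.real (Set.diagonal Ω)ᶜ)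
    rwa [← div_eq_mul_inv] at h
  have hle : ∀ j, ((fun m : Measure (Ω × Ω) => m.bind Khat)^[k + j * L] μ₀).real (Set.diagonal Ω)ᶜ ≤
      (1 - (w x₀)⁻¹) ^ k * μ₀.real (Set.diagonal Ω)ᶜ * ((1 - (w x₀)⁻¹) ^ L) ^ j := fun j => by
    have h := iterate_bind_crnPair_offDiagonal_le hw hw0 hmax Khat hK (k + j * L) μ₀
    rw [pow_add, pow_mul'] at h
    linarith [h]
  have hsum : Summable (fun j => ((fun m : Measure (Ω × Ω) => m.bind Khat)^[k + j * L] μ₀).real (Set.diagonal Ω)ᶜ) :=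
    Summable.of_nonneg_of_le (fun j => measureReal_nonneg) hle hgeo.summable
  exact ⟨hsum, (hsum.tsum_le_tsum hle hgeo.summable).trans_eq hgeo.tsum_eq⟩

/-- **LAG `L`: `|π f − E f(Y_k)| ≤ (c − a)·Σ_{j≥0} P(X_{k+jL} ≠ X′_{k+jL})` FOR EVERY MEASURABLE `a ≤ f ≤ c`** under the lag-`L` coupling
(`μ̂₀∘fst⁻¹ = (μ̂₀∘snd⁻¹)K^L`, `L ≥ 1`) — only every `L`-th disagreement probability enters. [ours] -/
theorem crnLagL_bias_abs_le_tsum_offDiagonal [MeasurableEq Ω] [Fact (Measurable w)] (hw0 : ∀ y, 0 < w y) {x₀ : Ω}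
    (hmax : ∀ y, w y ≤ w x₀) [IsProbabilityMeasure (q.withDensity fun y => ENNReal.ofReal (w y))]
    (Khat : Kernel (Ω × Ω) (Ω × Ω)) [IsMarkovKernel Khat]
    (hK : ∀ z : Ω × Ω, Khat z = (q.prod (volume : Measure unitInterval)).map (fun p : Ω × unitInterval =>
      ((if (p.2 : ℝ) * w z.1 ≤ w p.1 then p.1 else z.1), (if (p.2 : ℝ) * w z.2 ≤ w p.1 then p.1 else z.2))))
    (μ₀ : Measure (Ω × Ω)) [IsProbabilityMeasure μ₀] {L : ℕ} (hL : 1 ≤ L)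
    (hlag : μ₀.map Prod.fst = (fun m : Measure Ω => m.bind (indepMH q w))^[L] (μ₀.map Prod.snd))
    {f : Ω → ℝ} (hf : Measurable f) {a c : ℝ} (ha : ∀ x, a ≤ f x) (hc : ∀ x, f x ≤ c) (k : ℕ) :
    |∫ x, f x ∂(q.withDensity fun y => ENNReal.ofReal (w y)) -
        ∫ z, f ((z k).2) ∂(Kernel.trajMeasure (X := fun _ : ℕ => Ω × Ω) μ₀
          (fun n : ℕ => Khat.comap (fun h : (i : ↥(Finset.Iic n)) → Ω × Ω => h ⟨n, Finset.mem_Iic.2 le_rfl⟩)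
            (measurable_pi_apply _)))| ≤
      (c - a) * ∑' j, ((fun m : Measure (Ω × Ω) => m.bind Khat)^[k + j * L] μ₀).real (Set.diagonal Ω)ᶜ := by
  have hw : Measurable w := Fact.out
  have hhas := crnLagL_hasSum_integral_diff hw0 hmax Khat hK μ₀ hL hlag hf ha hc k
  obtain ⟨hsum, -⟩ := crn_chain_summable_offDiagonal_lagL hw hw0 hmax Khat hK μ₀ k hL
  rw [← hhas.tsum_eq]
  have hterm : ∀ j, ‖∫ z, (f ((z (k + j * L)).1) - f ((z (k + j * L)).2))
      ∂(Kernel.trajMeasure (X := fun _ : ℕ => Ω × Ω) μ₀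
        (fun n : ℕ => Khat.comap (fun h : (i : ↥(Finset.Iic n)) → Ω × Ω => h ⟨n, Finset.mem_Iic.2 le_rfl⟩)
          (measurable_pi_apply _)))‖ ≤ (c - a) * ((fun m : Measure (Ω × Ω) => m.bind Khat)^[k + j * L] μ₀).real (Set.diagonal Ω)ᶜ :=
    fun j => by
    rw [Real.norm_eq_abs]
    exact (abs_integral_le_integral_abs).trans (crnLag_integral_abs_diff_le_offDiagonal Khat μ₀ hf ha hc (k + j * L))
  rw [← Real.norm_eq_abs, ← tsum_mul_left]
  exact tsum_of_norm_bounded (hsum.mul_left (c - a)).hasSum hterm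

/-- **LAG `L`, TOTAL-VARIATION FORM**: for every measurable `S`, `|π(S) − P(Y_k ∈ S)| ≤ Σ_{j≥0} P(X_{k+jL} ≠ X′_{k+jL})`. [ours] -/
theorem crnLagL_measureReal_sub_abs_le_tsum_offDiagonal [MeasurableEq Ω] [Fact (Measurable w)] (hw0 : ∀ y, 0 < w y) {x₀ : Ω}
    (hmax : ∀ y, w y ≤ w x₀) [IsProbabilityMeasure (q.withDensity fun y => ENNReal.ofReal (w y))]
    (Khat : Kernel (Ω × Ω) (Ω × Ω)) [IsMarkovKernel Khat]
    (hK : ∀ z : Ω × Ω, Khat z = (q.prod (volume : Measure unitInterval)).map (fun p : Ω × unitInterval =>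
      ((if (p.2 : ℝ) * w z.1 ≤ w p.1 then p.1 else z.1), (if (p.2 : ℝ) * w z.2 ≤ w p.1 then p.1 else z.2))))
    (μ₀ : Measure (Ω × Ω)) [IsProbabilityMeasure μ₀] {L : ℕ} (hL : 1 ≤ L)
    (hlag : μ₀.map Prod.fst = (fun m : Measure Ω => m.bind (indepMH q w))^[L] (μ₀.map Prod.snd))
    {S : Set Ω} (hS : MeasurableSet S) (k : ℕ) :
    |(q.withDensity fun y => ENNReal.ofReal (w y)).real S -
        (Kernel.trajMeasure (X := fun _ : ℕ => Ω × Ω) μ₀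
          (fun n : ℕ => Khat.comap (fun h : (i : ↥(Finset.Iic n)) → Ω × Ω => h ⟨n, Finset.mem_Iic.2 le_rfl⟩)
            (measurable_pi_apply _))).real {z | (z k).2 ∈ S}| ≤
      ∑' j, ((fun m : Measure (Ω × Ω) => m.bind Khat)^[k + j * L] μ₀).real (Set.diagonal Ω)ᶜ := by
  have h := crnLagL_bias_abs_le_tsum_offDiagonal hw0 hmax Khat hK μ₀ hL hlag (measurable_one.indicator hS)
    (a := 0) (c := 1) (fun x => Set.indicator_nonneg (fun _ _ => zero_le_one) x)
    (fun x => Set.indicator_le_self' (fun _ _ => zero_le_one) x) k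
  rw [integral_indicator_one hS, sub_zero, one_mul] at h
  have hfun : (fun z : ℕ → Ω × Ω => S.indicator (1 : Ω → ℝ) ((z k).2)) =
      ({z : ℕ → Ω × Ω | (z k).2 ∈ S}).indicator (1 : (ℕ → Ω × Ω) → ℝ) := by
    funext z
    by_cases hz : (z k).2 ∈ S
    · rw [Set.indicator_of_mem hz, Set.indicator_of_mem (show z ∈ {z : ℕ → Ω × Ω | (z k).2 ∈ S} from hz)]; rfl
    · rw [Set.indicator_of_notMem hz, Set.indicator_of_notMem (show z ∉ {z : ℕ → Ω × Ω | (z k).2 ∈ S} from hz)]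
  have hSm : MeasurableSet {z : ℕ → Ω × Ω | (z k).2 ∈ S} := hS.preimage (measurable_snd.comp (measurable_pi_apply k))
  rw [hfun, integral_indicator_one hSm] at h
  exact h

/-- **LAG `L`: `Σ_{j≥0} P(X_{k+jL} ≠ X′_{k+jL}) = E[Σ_{j≥0} 1{Z_{k+jL} ∉ Δ}]`** — the expected number of READINGS after time `k` on which the runs
still differ (every initial coupling). [ours] -/
theorem crn_chain_integral_residualDisagreement_lagL_eq [MeasurableEq Ω] (hw : Measurable w) (hw0 : ∀ y, 0 < w y) {x₀ : Ω}
    (hmax : ∀ y, w y ≤ w x₀) [IsProbabilityMeasure (q.withDensity fun y => ENNReal.ofReal (w y))]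
    (Khat : Kernel (Ω × Ω) (Ω × Ω)) [IsMarkovKernel Khat]
    (hK : ∀ z : Ω × Ω, Khat z = (q.prod (volume : Measure unitInterval)).map (fun p : Ω × unitInterval =>
      ((if (p.2 : ℝ) * w z.1 ≤ w p.1 then p.1 else z.1), (if (p.2 : ℝ) * w z.2 ≤ w p.1 then p.1 else z.2))))
    (μ₀ : Measure (Ω × Ω)) [IsProbabilityMeasure μ₀] (k : ℕ) {L : ℕ} (hL : 1 ≤ L) :
    ∫ z, (∑' j, (Set.diagonal Ω)ᶜ.indicator (1 : Ω × Ω → ℝ) (z (k + j * L)))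
        ∂(Kernel.trajMeasure (X := fun _ : ℕ => Ω × Ω) μ₀
          (fun n : ℕ => Khat.comap (fun h : (i : ↥(Finset.Iic n)) → Ω × Ω => h ⟨n, Finset.mem_Iic.2 le_rfl⟩)
            (measurable_pi_apply _))) =
      ∑' j, ((fun m : Measure (Ω × Ω) => m.bind Khat)^[k + j * L] μ₀).real (Set.diagonal Ω)ᶜ := by
  set P := Kernel.trajMeasure (X := fun _ : ℕ => Ω × Ω) μ₀
      (fun n : ℕ => Khat.comap (fun h : (i : ↥(Finset.Iic n)) → Ω × Ω => h ⟨n, Finset.mem_Iic.2 le_rfl⟩)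
        (measurable_pi_apply _)) with hP
  obtain ⟨hsum, -⟩ := crn_chain_summable_offDiagonal_lagL hw hw0 hmax Khat hK μ₀ k hL
  have hD : MeasurableSet (Set.diagonal Ω) := measurableSet_diagonal
  have hIm : Measurable ((Set.diagonal Ω)ᶜ.indicator (1 : Ω × Ω → ℝ)) := measurable_one.indicator hD.compl
  have hIi : ∀ j, Integrable (fun z : ℕ → Ω × Ω => (Set.diagonal Ω)ᶜ.indicator (1 : Ω × Ω → ℝ) (z (k + j * L))) P := fun j =>
    integrable_of_bounded P (hIm.comp (measurable_pi_apply (k + j * L))) (fun z => abs_indicator_offDiagonal_le_one _)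
  have hterm : ∀ j, ∫ z, (Set.diagonal Ω)ᶜ.indicator (1 : Ω × Ω → ℝ) (z (k + j * L)) ∂P =
      ((fun m : Measure (Ω × Ω) => m.bind Khat)^[k + j * L] μ₀).real (Set.diagonal Ω)ᶜ := fun j => by
    rw [hP, chain_expect_eq_integral_iterate_bind Khat μ₀ hIm (fun p => abs_indicator_offDiagonal_le_one p) (k + j * L),
      integral_indicator_one hD.compl]
  have hnorm : ∀ j, ∫ z, ‖(Set.diagonal Ω)ᶜ.indicator (1 : Ω × Ω → ℝ) (z (k + j * L))‖ ∂P =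
      ((fun m : Measure (Ω × Ω) => m.bind Khat)^[k + j * L] μ₀).real (Set.diagonal Ω)ᶜ := fun j => by
    rw [← hterm j]
    refine integral_congr_ae (ae_of_all _ fun z => ?_)
    dsimp only
    rw [Real.norm_eq_abs]
    exact abs_of_nonneg (Set.indicator_nonneg (fun _ _ => zero_le_one) _)
  have hsum' : Summable (fun j => ∫ z, ‖(Set.diagonal Ω)ᶜ.indicator (1 : Ω × Ω → ℝ) (z (k + j * L))‖ ∂P) := by
    simp_rw [hnorm]; exact hsum
  rw [← integral_tsum_of_summable_integral_norm hIi hsum']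
  exact tsum_congr hterm

end Summit.Ventures.LatticeQCDFlow.Exactness

end
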